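import Literature.NumberTheory.Automorphic.ShintaniWhittakerTranslate
import Literature.NumberTheory.Automorphic.RankinSelbergTorusIntegral
import HarnessLib

/-!
# The translated global Whittaker coefficient is an unramified torus datum (any conductor)

Topic `NumberTheory/Automorphic`; namespace `Literature.NumberTheory.Automorphic`. Theorems only.
`exists_isTorusUnramifiedAt_whittakerCoeff_smoothedForm` (`RankinSelbergTorusIntegral`) says: the
global Whittaker coefficient `W = W_φ` of a smoothed cuspidal vector `φ = invQuot (S_η f)` of level
`K(𝔫₀)` is an unramified Whittaker–Hecke datum in the torus sense (`IsTorusUnramifiedAt`) at every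
`v ∤ 𝔫₀` off the Satake set AT WHICH `ψ_v` HAS CONDUCTOR `𝒪_v`. For the standard adelic character
this excludes the places dividing the different `𝔡_K`. Here the conductor hypothesis is removed at
the price of a translation: if `T ∈ GL_n(𝔸_K)` has `v`-component a diagonal matrix `d = diag(d_i)`
with constant ratios `d_i / d_{i+1} = a` such that `ψ_v(a ·)` has conductor `𝒪_v` (for `ψ_v` of
conductor `ϖ^{-e} 𝒪_v`: `a = ϖ^{-e}`, `d` the Whittaker shift `t_e`, `ShintaniWhittakerTranslate`),
then the LEFT translate `g ↦ W(T g)` is an unramified torus datum at `v` with the same parameters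
(`exists_isTorusUnramifiedAt_whittakerCoeff_smoothedForm_translate`). Proof: write `T = ι_v(d) T'`
with `T'_v = 1`; `T'` commutes with `ι_v(GL_n(K_v))`
(`GLn.ofLocal_mul_eq_mul_ofLocal_of_toLocal_eq_one`), so `W(T ι_v(ϖ^μ) g) = W(ι_v(d ϖ^μ) (T' g))` and
the translated Shintani formula `apply_diagonalGL_mul_piPowGL_eq_schur_mul` applies to the local
datum `y ↦ W(ι_v(y) T' g)` of `isUnramifiedWhittakerDatum_whittakerCoeff_ofLocal` (valid for every
global `ψ`). This is the unramified computation "with `ψ_v` not normalized, translating the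
essential vector" (Cogdell (2004), §3.1, Thm. 3.3), for the honest global coefficient.

## References

* T. Shintani, Proc. Japan Acad. 52 (1976), Theorem (p. 181) [Shintani1976].
* J. W. Cogdell, *Analytic theory of L-functions for GL_n* (2004), §3.1, Thm. 3.3
  [CogdellAnalyticTheory2004].
-/

noncomputable section

open MeasureTheory Measure NumberField IsDedekindDomain Matrix Set Filter Finset ValuativeRel
open scoped MatrixGroups ENNReal NNReal ComplexConjugate Pointwise
open Literature.RingTheory.SymmetricFunctions.SymmPoly

namespace Literature.NumberTheory.Automorphic

section Cuspidal

variable {n : ℕ} {K : Type} [Field K] [NumberField K]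
  {μ : Measure (AdelicGroupData.gl n K).automorphicQuotient}
  [(AdelicGroupData.gl n K).IsAutomorphicMeasure μ]
variable [MeasurableSpace ↥(adelicUnipotent n K)] [BorelSpace ↥(adelicUnipotent n K)]
  [MeasurableConstSMul ↥(rationalUnipotent n K) ↥(adelicUnipotent n K)]
  {ν : Measure ↥(adelicUnipotent n K)} [IsFiniteMeasureOnCompacts ν]
  [SMulInvariantMeasure ↥(rationalUnipotent n K) ↥(adelicUnipotent n K) ν] [ν.IsMulRightInvariant]
  {𝓕 : Set ↥(adelicUnipotent n K)} {ψ : AddChar (AdeleRing (𝓞 K) K) Circle}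

/-- **The translated global Whittaker coefficient of a smoothed cuspidal vector is an unramified torus
datum, for `ψ_v` of any conductor.** Let `Π` be a cuspidal automorphic representation of
`GL_n(𝔸_K)` with Satake family `α` off `S`, `f ∈ Π`, `η` a continuous compactly supported left
`K(𝔫₀)`-invariant weight (`𝔫₀ ≠ 0`), `φ = invQuot (S_η f)`, `W = W_φ`, `ψ` a global additive
character, `𝓕` a relatively compact fundamental domain of `N_n(K)` in `N_n(𝔸_K)`, `v ∉ S`, `v ∤ 𝔫₀`,
`x` an enumeration of `α v`; let `T ∈ GL_n(𝔸_K)` have `v`-component `diag(d_i)` with constant ratios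
`d_i d_{i+1}⁻¹ = a`, where `ψ_v(a ·)` has conductor `𝒪_v` (trivial on `𝒪_v`, non-trivial on
`ϖ⁻¹ 𝒪_v` for every normalised uniformizer). Then for the uniformizer `ϖ` of the Satake datum,
`g ↦ W(T g)` is an unramified torus datum at `v` with parameters `x`:
`W(T ι_v(ϖ^μ) g) = q_v^{-b(μ)/2} s_μ(x) W(T g)` for `g_v = 1` (with the vanishing off the antitone
cone) and right `ι_v(GL_n(𝒪_v))`-invariance. [cite: Shintani1976, Theorem (p. 181)]
[cite: CogdellAnalyticTheory2004, §3.1, Thm. 3.3] -/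
theorem exists_isTorusUnramifiedAt_whittakerCoeff_smoothedForm_translate
    (P : CuspidalAutomorphicRepGL n K μ)
    {S : Set (HeightOneSpectrum (𝓞 K))} {α : SatakeFamily K} (hα : IsSatakeFamilyOf P S α)
    {𝔫₀ : Ideal (𝓞 K)} (h𝔫₀ : 𝔫₀ ≠ 0) {v : HeightOneSpectrum (𝓞 K)} (hvS : v ∉ S)
    (hv : ¬ v.asIdeal ∣ 𝔫₀) {η : (AdelicGroupData.gl n K).Adelic → ℝ} (hη : Continuous η)
    (hηs : HasCompactSupport η)
    (hηK : ∀ k : (AdelicGroupData.gl n K).Adelic, k ∈ principalCongruenceLevel n K 𝔫₀ →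
      ∀ g : (AdelicGroupData.gl n K).Adelic, η (k * g) = η g)
    (f : P.1.toSubmodule) {x : Fin n → ℂ} (hx : (Finset.univ : Finset (Fin n)).val.map x = α v)
    (h𝓕 : IsFundamentalDomain ↥(rationalUnipotent n K) 𝓕 ν) (h𝓕c : IsCompact (closure 𝓕))
    (hψ : IsGlobalAddChar K ψ) {T : GL (Fin n) (AdeleRing (𝓞 K) K)}
    {d : Fin n → (v.adicCompletion K)ˣ} {a : (v.adicCompletion K)ˣ}
    (hT : localComponent v T = diagonalGL (Fin n) (v.adicCompletion K) d)
    (hd : ∀ i j : Fin n, (i : ℕ) + 1 = j → (d i : v.adicCompletion K) * ((d j)⁻¹ : (v.adicCompletion K)ˣ) = a)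
    (hψa : ∀ c ∈ 𝒪[v.adicCompletion K], ψ.adicComponent v (a * c) = 1)
    (hψa' : ∀ ϖ : v.adicCompletion K, Valued.v ϖ = WithZero.exp (-1 : ℤ) →
      ∃ c ∈ 𝒪[v.adicCompletion K], ψ.adicComponent v (a * (ϖ⁻¹ * c)) ≠ 1) :
    ∃ ϖ : (v.adicCompletion K)ˣ, IsTorusUnramifiedAt n K
      (fun g => whittakerCoeff ν 𝓕 ψ
        (invQuot (AdelicGroupData.gl n K) (smoothedForm η (f : (AdelicGroupData.gl n K).L2 μ))) (T * g))
      v ϖ x := by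
  obtain ⟨ϖ, hϖ, hHecke⟩ := sum_invQuot_smoothedForm_mul_ofLocal_rep_eq P hα h𝔫₀ hvS hv hη hηs hηK f hx
  set φ : GL (Fin n) (AdeleRing (𝓞 K) K) → ℂ :=
    invQuot (AdelicGroupData.gl n K) (smoothedForm η (f : (AdelicGroupData.gl n K).L2 μ)) with hφ
  have hφK : ∀ k ∈ glInt n (v.adicCompletion K), ∀ y : GL (Fin n) (AdeleRing (𝓞 K) K),
      φ (y * GLn.ofLocal n K v k) = φ y :=
    fun k hk y => invQuot_smoothedForm_mul_ofLocal h𝔫₀ hv hηK _ hk y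
  have hint : ∀ g, IntegrableOn (fun u : ↥(adelicUnipotent n K) =>
      φ ((u : GL (Fin n) (AdeleRing (𝓞 K) K)) * g) * conj (whittakerCharFun ψ u)) 𝓕 ν := fun g =>
    integrableOn_whittakerIntegrand_of_continuous h𝓕c hψ.continuous
      (continuous_invQuot_smoothedForm hη hηs _) g
  have hs : (((Real.sqrt (v.residueCard : ℝ) : ℝ) : ℂ)) ≠ 0 := by
    rw [Complex.ofReal_ne_zero, Real.sqrt_ne_zero']
    exact_mod_cast zero_lt_one.trans v.one_lt_residueCard
  have hq' : ((Nat.card 𝓀[v.adicCompletion K] : ℕ) : ℂ) =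
      (((Real.sqrt (v.residueCard : ℝ) : ℝ) : ℂ)) ^ 2 := by
    rw [natCard_valuativeResidueField_adicCompletion_eq, ← Complex.ofReal_pow,
      Real.sq_sqrt (Nat.cast_nonneg _), Complex.ofReal_natCast]
  obtain ⟨c, hc, hcne⟩ := hψa' ϖ hϖ
  -- `T = ι_v(d) T'` with `T'_v = 1`
  set T' : GL (Fin n) (AdeleRing (𝓞 K) K) := T * GLn.ofLocal n K v (localComponent v T)⁻¹ with hT'
  have hT'1 : Matrix.GeneralLinearGroup.map (AdelicGroupData.adeleEval K v) T' = 1 :=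
    localComponent_mul_ofLocal_inv T
  have hTT' : T = GLn.ofLocal n K v (diagonalGL (Fin n) (v.adicCompletion K) d) * T' := by
    rw [hT', ← hT, GLn.ofLocal_mul_eq_mul_ofLocal_of_toLocal_eq_one _ hT'1, mul_assoc, ← map_mul,
      inv_mul_cancel, map_one, mul_one]
  clear_value T'
  -- `T'` commutes with `ι_v(GL_n(K_v))`
  have key : ∀ (y : GL (Fin n) (v.adicCompletion K)) (X : GL (Fin n) (AdeleRing (𝓞 K) K)),
      T * (GLn.ofLocal n K v y * X) =
        GLn.ofLocal n K v (diagonalGL (Fin n) (v.adicCompletion K) d * y) * (T' * X) := fun y X => by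
    rw [hTT', map_mul]
    simp only [mul_assoc]
    congr 1
    rw [← mul_assoc, ← GLn.ofLocal_mul_eq_mul_ofLocal_of_toLocal_eq_one y hT'1, mul_assoc]
  refine ⟨ϖ, hϖ, fun k hk g => ?_, fun g hg mu => ?_⟩
  · -- sphericity
    show whittakerCoeff ν 𝓕 ψ φ (T * (g * GLn.ofLocal n K v k)) = whittakerCoeff ν 𝓕 ψ φ (T * g)
    rw [← mul_assoc]
    exact whittakerCoeff_mul_of_forall ν 𝓕 ψ (hφK k hk) _
  · -- Shintani along `d ϖ^μ` for the local datum `y ↦ W(ι_v(y) T' g)`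
    have hg' : Matrix.GeneralLinearGroup.map (AdelicGroupData.adeleEval K v) (T' * g) = 1 := by
      rw [map_mul, hT'1, hg, one_mul]
    have hD := isUnramifiedWhittakerDatum_whittakerCoeff_ofLocal h𝓕 hψ (isLeftInvariant_invQuot _ _) hφK
      (isUniformizingElement_of_valued_eq K v hϖ) hHecke hint hg'
    have h1 : T * (GLn.ofLocal n K v (piPowGL (isUniformizingElement_of_valued_eq K v hϖ).ne_zero mu) * g) =
        GLn.ofLocal n K v (diagonalGL (Fin n) (v.adicCompletion K) d *
          piPowGL (isUniformizingElement_of_valued_eq K v hϖ).ne_zero mu) * (T' * g) := key _ g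
    have h2 : T * g = GLn.ofLocal n K v (diagonalGL (Fin n) (v.adicCompletion K) d) * (T' * g) := by
      rw [hTT', mul_assoc]
    show whittakerCoeff ν 𝓕 ψ φ (T * (GLn.ofLocal n K v _ * g)) = _ * whittakerCoeff ν 𝓕 ψ φ (T * g)
    rw [h1, h2]
    by_cases hmu : Antitone mu
    · rw [schurTrunc, if_pos hmu]
      exact apply_diagonalGL_mul_piPowGL_eq_schur_mul hD d a hd hψa ⟨c, hc, hcne⟩ hs hq' hmu
    · rw [schurTrunc, if_neg hmu, mul_zero, zero_mul]
      exact apply_diagonalGL_mul_piPowGL_eq_zero_of_not_antitone hD d a hd ⟨c, hc, hcne⟩ hmu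

end Cuspidal

end Literature.NumberTheory.Automorphic
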